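import Literature.Analysis.FluidPDE.DistributionalToWeakCounterexample
import Literature.Analysis.FluidPDE.TaoEnstrophyLocalisationProofs
import Literature.Analysis.FluidPDE.JiaSverak2013Lemma8SliceTools
import Mathlib.MeasureTheory.Measure.Haar.NormedSpace
import Mathlib.MeasureTheory.Measure.Lebesgue.EqHaar
import Mathlib.Analysis.Normed.Group.Bounded
import HarnessLib

/-!
# Barrier: ENERGY DISPERSAL DOES NOT CONTROL THE ENSTROPHY — a length read off the energy density `|u|²`
# (half-energy radius, concentration function) never bounds the dissipation length `(E/X)^{1/2}` from above

Barrier catalogue entry for `NavierStokesRegularity` (D-0021), METHOD LEVEL, everything PROVED (zero fact debt).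
Companion of `ScalingAudit` (homogeneity exponents must match) and `EnergySupercriticality`: this entry covers the
laws that PASS the dilation audit — scale-invariant combinations `R(u)²·X(u) ≤ C·E(u)` of an energy-geometry LENGTH
`R(u)` with the energy `E = ∫|u|²` and the enstrophy `X = ∫|∇u|²_F` — and records why they still fail.
STRUCTURED BLOCK (cell `ns-claims` MAP-SCHEMA §5):
* technique_class: «energy bookkeeping + Gagliardo–Nirenberg/Hölder on balls ⇒ an a-priori SCALE LAW tying an
  energy-concentration radius to the enstrophy» (T1/T3 energy-class arguments with a concentration length).
* blocks: every law `R(u)²·X(u) ≤ C·E(u)` (any universal `C`) whose length `R(u)` is `≥ r` whenever no ball of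
  radius `r` carries a quarter of the energy (half-energy radius `inf{ρ : ∃x₀, ∫_{B(x₀,ρ)}|u|² ≥ ½∫|u|²}`,
  concentration-function radii, …), on smooth compactly supported divergence-free fields on `ℝ³` (Clay data, `t = 0`).
* because (kernel, `energyDispersalNoEnstrophyControl_holds`): for every `r > 0` and `C` the TWO-SCALE field
  `u = θ(·/L) + λθ(λ·)` (`twoScale`; `θ = curl(η e₂)` the tree's `C_c^∞` divergence-free field) has, for suitable
  `L, λ`, EVERY `r`-ball carrying `< ¼∫|u|²` (the spread copy holds the energy: sup-bound × ball volume) and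
  `r²∫|∇u|²_F ≥ C∫|u|² > 0` (the concentrated copy holds the gradient square `~λ`, energy `~λ⁻¹`); only dilation
  bookkeeping (`∫g(c·) = c⁻³∫g`, `∫|D(f(c·))|²_F = c⁻¹∫|Df|²_F`) and pointwise inequalities — no oscillatory integrals.
* mechanism (what the sources print): a length built from `|u|²` is a PHYSICAL-space statistic of the energy
  distribution, while the dissipation length is the inverse FREQUENCY moment `κ_{1,0} = (H₁/H₀)^{1/2}` —
  Doering–Gibbon §6.3 «A natural definition of a length scale» (pp. 125–127): «The term "smallest length scale" is
  not uniquely defined and so requires some thought», moments «`[k^{2N}]_{s.a.} = ∫|k|^{2N}|û|²/∫|û|² := H_N/H_0`»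
  (6.3.4), wavenumbers «`κ_{N,r}(t) = (F_N/F_r)^{1/2(N−r)}`» (Def. 6.1 (6.3.8))
  [cite: DoeringGibbon1995, §6.3 (6.3.4)–(6.3.8) pp.125–127]; a spread plus a concentrated component move the two
  statistics independently — Tao's supercriticality heuristic («the rescaled unit-scale solution can be as bad as
  an arbitrary smooth vector field with kinetic energy … at most `Eλ`») in a form the ONE-parameter dilation audit
  cannot see: `R²X/E` is invariant under `u ↦ u(λ·)` and `u ↦ a·u`.
  [cite: Tao2007WhyNSHard, supercriticality paragraph (rescaling `u^{(λ)}`)]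
* evasions_known: (a) the CONVERSE direction is true (a ball of radius `R` holding half of `∫|u|²` forces
  `R²X ≳ E`: Sobolev `H¹ ⊂ L⁶` + Hölder on the ball; cell record: `Literature.Claims.NS.Alneel2026.Step_P3rev` true
  for small `C`); (b) a law valid only at POSITIVE times along the flow is not excluded by data — but «for all
  `t ∈ [0,T)`» contains `t = 0`; (c) a FREQUENCY-side hypothesis (band-limited data) changes the class — see
  `BandLimitedClassNotInvariant`.
* scope_caveats: `ℝ³`; `C_c^∞` divergence-free fields; Frobenius gradient square; threshold `¼` = «half of
  `E₀ = ½∫|u|²`»; constants not optimised.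
* status: PROVED here; cell instance C156 `Literature.Claims.NS.Alneel2026` (Zenodo 21706638, Thm 2.1 p.2 l.2–6
  `Thm21` «R(t)²X(t) ≤ 16C_GN E₀», display (6) p.2 l.43–49 `Step6_display`; head of record FL @ `Step_P3tail`
  p.3 l.28–49 by `…Theorems.Alneel2026.not_Step_P3tail`; Theorem 2.1 refuted ∀C Summits-side by the second refuter's
  modulated witness `…Theorems.Alneel2026Second.not_Thm21`). This file is the claim-independent METHOD statement
  (two-scale superposition, no claim vocabulary); seat `ns-claims-salvage-p3` g5.

WHAT THIS IS NOT: not a claim about NS regularity or blow-up; not a claim about any author beyond the typed locator.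
-/

noncomputable section

open Set MeasureTheory Filter Metric Function
open scoped ENNReal NNReal Topology ContDiff

namespace Literature.Barriers.NavierStokesRegularity

namespace EnergyDispersal

open Literature.Analysis Literature.Analysis.FluidPDE
open Literature.Analysis.FluidPDE.DistributionalToWeakCounterexample (θ θ_contDiff θ_hasCompactSupport
  θ_isDivFree exists_θ_ne_zero)

local notation "E3" => EuclideanSpace ℝ (Fin 3)

/-- `∫ g(c x) dx = (c³)⁻¹ ∫ g` on `ℝ³`, `c > 0`. [folklore] -/
private theorem integral_comp_smul_three (g : E3 → ℝ) {c : ℝ} (hc : 0 < c) :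
    ∫ x, g (c • x) = (c ^ 3)⁻¹ * ∫ y, g y := by
  rw [Measure.integral_comp_smul volume g c, finrank_euclideanSpace_fin, smul_eq_mul,
    abs_of_nonneg (by positivity)]

/-- `c² (c³)⁻¹ = c⁻¹` for `c ≠ 0`. [folklore] -/
private theorem sq_mul_inv_cube {c : ℝ} (hc : c ≠ 0) : c ^ 2 * (c ^ 3)⁻¹ = c⁻¹ := by
  rw [show c ^ 3 = c ^ 2 * c by ring, mul_inv, ← mul_assoc, mul_inv_cancel₀ (pow_ne_zero 2 hc), one_mul]

/-- The Frobenius gradient square of a dilate: `∫ |D(f(c·))|²_F = c⁻¹ ∫ |Df|²_F` (`c > 0`). [folklore] -/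
private theorem integral_frob_comp_smul (f : E3 → E3) {c : ℝ} (hc : 0 < c) :
    ∫ x, frobeniusNormSq (fderiv ℝ (fun y => f (c • y)) x) = c⁻¹ * ∫ y, frobeniusNormSq (fderiv ℝ f y) := by
  have h : ∀ x, fderiv ℝ (fun y => f (c • y)) x = c • fderiv ℝ f (c • x) := fun x =>
    fderiv_comp_smul c
  simp_rw [h, frobeniusNormSq_smul_eq]
  rw [integral_const_mul, integral_comp_smul_three (fun y => frobeniusNormSq (fderiv ℝ f y)) hc, ← mul_assoc,
    sq_mul_inv_cube hc.ne']

/-- `‖p + q‖² ≤ 2‖p‖² + 2‖q‖²`. [folklore] -/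
private theorem norm_add_sq_le_two (p q : E3) : ‖p + q‖ ^ 2 ≤ 2 * ‖p‖ ^ 2 + 2 * ‖q‖ ^ 2 := by
  have h := norm_add_le p q
  have h2 : ‖p + q‖ ^ 2 ≤ (‖p‖ + ‖q‖) ^ 2 := pow_le_pow_left₀ (norm_nonneg _) h 2
  nlinarith [sq_nonneg (‖p‖ - ‖q‖)]

/-- `‖p + q‖² ≥ ½‖p‖² − ‖q‖²`. [folklore] -/
private theorem norm_add_sq_ge (p q : E3) : (1 / 2) * ‖p‖ ^ 2 - ‖q‖ ^ 2 ≤ ‖p + q‖ ^ 2 := by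
  have h1 : ‖p‖ ≤ ‖p + q‖ + ‖q‖ := by
    calc ‖p‖ = ‖(p + q) - q‖ := by rw [add_sub_cancel_right]
      _ ≤ ‖p + q‖ + ‖q‖ := norm_sub_le _ _
  nlinarith [norm_nonneg p, norm_nonneg q, norm_nonneg (p + q), sq_nonneg (‖p + q‖ - ‖q‖)]

/-- `|A + B|²_F ≥ ½|B|²_F − |A|²_F` (column by column). [folklore] -/
private theorem frobeniusNormSq_add_ge (A B : E3 →L[ℝ] E3) :
    (1 / 2) * frobeniusNormSq B - frobeniusNormSq A ≤ frobeniusNormSq (A + B) := by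
  unfold frobeniusNormSq
  rw [Finset.mul_sum, ← Finset.sum_sub_distrib]
  refine Finset.sum_le_sum fun i _ => ?_
  have h := norm_add_sq_ge (B (stdOrthonormalBasis ℝ E3 i)) (A (stdOrthonormalBasis ℝ E3 i))
  rw [show (A + B) (stdOrthonormalBasis ℝ E3 i) = A (stdOrthonormalBasis ℝ E3 i) + B (stdOrthonormalBasis ℝ E3 i)
    from rfl, add_comm (A _)]
  linarith

/-- **The two-scale field** `f(x/L) + λ f(λx)`: a SPREAD copy of `f` (carries the energy, dispersed over a
region of size `~L`) plus a CONCENTRATED copy (gradient square `~λ`, energy `~λ⁻¹`). [folklore] -/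
def twoScale (f : E3 → E3) (L lam : ℝ) (x : E3) : E3 :=
  f (L⁻¹ • x) + lam • f (lam • x)

variable {f : E3 → E3}

/-- kit lemma (plumbing): a dilate of a smooth field is smooth. [folklore] -/
private theorem contDiff_comp_smul (hf : ContDiff ℝ ∞ f) (c : ℝ) : ContDiff ℝ ∞ fun x : E3 => f (c • x) :=
  hf.comp (contDiff_const_smul c)

/-- kit lemma (plumbing): the two-scale field is smooth. [folklore] -/
private theorem contDiff_twoScale (hf : ContDiff ℝ ∞ f) (L lam : ℝ) : ContDiff ℝ ∞ (twoScale f L lam) :=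
  (contDiff_comp_smul hf L⁻¹).add ((contDiff_comp_smul hf lam).const_smul lam)

/-- kit lemma (plumbing): the two-scale field is compactly supported (`L, λ ≠ 0`). [folklore] -/
private theorem hasCompactSupport_twoScale (hfc : HasCompactSupport f) {L lam : ℝ} (hL : L ≠ 0) (hlam : lam ≠ 0) :
    HasCompactSupport (twoScale f L lam) := by
  refine (hfc.comp_smul (inv_ne_zero hL)).add ?_
  exact (hfc.comp_smul hlam).mono fun x hx => by
    contrapose! hx
    simp [notMem_support.1 hx]

/-- kit lemma (plumbing): a dilate of a divergence-free `C¹` field is divergence free. [folklore] -/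
private theorem isDivFree_comp_smul (hdiv : VectorCalculus.IsDivFree f) (c : ℝ) :
    VectorCalculus.IsDivFree fun x : E3 => f (c • x) := by
  intro x
  have hx := hdiv (c • x)
  simp only [VectorCalculus.divergence] at hx ⊢
  rw [fderiv_comp_smul, ContinuousLinearMap.toLinearMap_smul, map_smul, hx, smul_zero]

/-- kit lemma (plumbing): the two-scale field on a divergence-free `f` is divergence free. [folklore] -/
private theorem isDivFree_twoScale (hf : ContDiff ℝ ∞ f) (hdiv : VectorCalculus.IsDivFree f) (L lam : ℝ) :
    VectorCalculus.IsDivFree (twoScale f L lam) := by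
  intro x
  have h1 : DifferentiableAt ℝ (fun y : E3 => f (L⁻¹ • y)) x :=
    ((contDiff_comp_smul hf L⁻¹).differentiable (by simp)) x
  have h2 : DifferentiableAt ℝ (fun y : E3 => f (lam • y)) x :=
    ((contDiff_comp_smul hf lam).differentiable (by simp)) x
  have hA := isDivFree_comp_smul hdiv L⁻¹ x
  have hB := isDivFree_comp_smul hdiv lam x
  simp only [VectorCalculus.divergence] at hA hB ⊢
  unfold twoScale
  have h2' : DifferentiableAt ℝ (fun y : E3 => lam • f (lam • y)) x :=
    (((contDiff_comp_smul hf lam).const_smul lam).differentiable (by simp)) x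
  rw [fderiv_fun_add h1 h2', fderiv_fun_const_smul h2,
    ContinuousLinearMap.toLinearMap_add, map_add, ContinuousLinearMap.toLinearMap_smul, map_smul, hA, hB,
    smul_zero, add_zero]

/-- kit lemma (plumbing): `‖g‖²` is integrable for `g ∈ C_c^∞`. [folklore] -/
private theorem integrable_norm_sq_of {g : E3 → E3} (hg : ContDiff ℝ ∞ g) (hgc : HasCompactSupport g) :
    Integrable (fun x : E3 => ‖g x‖ ^ 2) := by
  have hsupp : HasCompactSupport fun x : E3 => ‖g x‖ ^ 2 :=
    (hgc.norm).comp_left (g := fun t : ℝ => t ^ 2) (by simp)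
  exact ((hg.continuous.norm).pow 2).integrable_of_hasCompactSupport hsupp

/-- kit lemma (plumbing): `|Dg|²_F` is integrable for `g ∈ C_c^∞`. [folklore] -/
private theorem integrable_frob_of {g : E3 → E3} (hg : ContDiff ℝ ∞ g) (hgc : HasCompactSupport g) :
    Integrable (fun x : E3 => frobeniusNormSq (fderiv ℝ g x)) := by
  have hsupp : HasCompactSupport fun x : E3 => frobeniusNormSq (fderiv ℝ g x) :=
    (hgc.fderiv (𝕜 := ℝ)).comp_left (g := frobeniusNormSq) (by simp [frobeniusNormSq])
  exact (continuous_frobeniusNormSq_fderiv hg (by simp)).integrable_of_hasCompactSupport hsupp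

section Estimates

variable (hf : ContDiff ℝ ∞ f) (hfc : HasCompactSupport f)
include hf hfc

/-- **Energy from above and below**: `(½L³ − λ⁻¹)∫‖f‖² ≤ ∫‖u_{L,λ}‖² ≤ (2L³ + 2λ⁻¹)∫‖f‖²`. [folklore] -/
private theorem integral_norm_sq_twoScale_bounds {L lam : ℝ} (hL : 0 < L) (hlam : 0 < lam) :
    ((1 / 2) * L ^ 3 - lam⁻¹) * ∫ y, ‖f y‖ ^ 2 ≤ ∫ x, ‖twoScale f L lam x‖ ^ 2 ∧
      ∫ x, ‖twoScale f L lam x‖ ^ 2 ≤ (2 * L ^ 3 + 2 * lam⁻¹) * ∫ y, ‖f y‖ ^ 2 := by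
  have hi1 := integrable_norm_sq_of (contDiff_comp_smul hf L⁻¹) (hfc.comp_smul (inv_ne_zero hL.ne'))
  have hi2 := integrable_norm_sq_of (contDiff_comp_smul hf lam) (hfc.comp_smul hlam.ne')
  have hint := integrable_norm_sq_of (contDiff_twoScale hf L lam) (hasCompactSupport_twoScale hfc hL.ne' hlam.ne')
  have hpt : ∀ x, (1 / 2) * ‖f (L⁻¹ • x)‖ ^ 2 - lam ^ 2 * ‖f (lam • x)‖ ^ 2 ≤ ‖twoScale f L lam x‖ ^ 2 ∧
      ‖twoScale f L lam x‖ ^ 2 ≤ 2 * ‖f (L⁻¹ • x)‖ ^ 2 + 2 * (lam ^ 2 * ‖f (lam • x)‖ ^ 2) := by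
    intro x
    have h := norm_add_sq_ge (f (L⁻¹ • x)) (lam • f (lam • x))
    have h' := norm_add_sq_le_two (f (L⁻¹ • x)) (lam • f (lam • x))
    rw [norm_smul, mul_pow, Real.norm_eq_abs, sq_abs] at h h'
    exact ⟨h, h'⟩
  have e1 : ∫ x, ‖f (L⁻¹ • x)‖ ^ 2 = L ^ 3 * ∫ y, ‖f y‖ ^ 2 := by
    rw [integral_comp_smul_three (fun y => ‖f y‖ ^ 2) (inv_pos.2 hL), inv_pow, inv_inv]
  have e2 : lam ^ 2 * ∫ x, ‖f (lam • x)‖ ^ 2 = lam⁻¹ * ∫ y, ‖f y‖ ^ 2 := by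
    rw [integral_comp_smul_three (fun y => ‖f y‖ ^ 2) hlam, ← mul_assoc, sq_mul_inv_cube hlam.ne']
  have hlo : ∫ x, ((1 / 2) * ‖f (L⁻¹ • x)‖ ^ 2 - lam ^ 2 * ‖f (lam • x)‖ ^ 2) ≤ ∫ x, ‖twoScale f L lam x‖ ^ 2 :=
    integral_mono ((hi1.const_mul (1 / 2)).sub (hi2.const_mul (lam ^ 2))) hint fun x => (hpt x).1
  have hhi : ∫ x, ‖twoScale f L lam x‖ ^ 2 ≤ ∫ x, (2 * ‖f (L⁻¹ • x)‖ ^ 2 + 2 * (lam ^ 2 * ‖f (lam • x)‖ ^ 2)) :=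
    integral_mono hint ((hi1.const_mul 2).add ((hi2.const_mul (lam ^ 2)).const_mul 2)) fun x => (hpt x).2
  rw [integral_sub (hi1.const_mul (1 / 2)) (hi2.const_mul (lam ^ 2)), integral_const_mul, integral_const_mul,
    e1, e2] at hlo
  rw [integral_add (hi1.const_mul 2) ((hi2.const_mul (lam ^ 2)).const_mul 2), integral_const_mul,
    integral_const_mul, integral_const_mul, e1, e2] at hhi
  constructor <;> linarith

/-- **Enstrophy from below**: `∫|D u_{L,λ}|²_F ≥ (½λ − L)∫|Df|²_F` (`L, λ > 0`). [folklore] -/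
private theorem integral_frob_twoScale_ge {L lam : ℝ} (hL : 0 < L) (hlam : 0 < lam) :
    ((1 / 2) * lam - L) * ∫ y, frobeniusNormSq (fderiv ℝ f y) ≤
      ∫ x, frobeniusNormSq (fderiv ℝ (twoScale f L lam) x) := by
  have hi1 := integrable_frob_of (contDiff_comp_smul hf L⁻¹) (hfc.comp_smul (inv_ne_zero hL.ne'))
  have hi2 := integrable_frob_of (contDiff_comp_smul hf lam) (hfc.comp_smul hlam.ne')
  have hd1 : ∀ x, DifferentiableAt ℝ (fun y : E3 => f (L⁻¹ • y)) x := fun x =>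
    ((contDiff_comp_smul hf L⁻¹).differentiable (by simp)) x
  have hd2 : ∀ x, DifferentiableAt ℝ (fun y : E3 => f (lam • y)) x := fun x =>
    ((contDiff_comp_smul hf lam).differentiable (by simp)) x
  have hd2' : ∀ x, DifferentiableAt ℝ (fun y : E3 => lam • f (lam • y)) x := fun x =>
    (((contDiff_comp_smul hf lam).const_smul lam).differentiable (by simp)) x
  -- the derivative of the two-scale field, split into its two pieces
  have hD : ∀ x, fderiv ℝ (twoScale f L lam) x =
      fderiv ℝ (fun y : E3 => f (L⁻¹ • y)) x + lam • fderiv ℝ (fun y : E3 => f (lam • y)) x := by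
    intro x
    have e : twoScale f L lam = fun y => f (L⁻¹ • y) + lam • f (lam • y) := rfl
    rw [e, fderiv_fun_add (hd1 x) (hd2' x), fderiv_fun_const_smul (hd2 x)]
  have hpt : ∀ x, (1 / 2) * (lam ^ 2 * frobeniusNormSq (fderiv ℝ (fun y : E3 => f (lam • y)) x)) -
      frobeniusNormSq (fderiv ℝ (fun y : E3 => f (L⁻¹ • y)) x) ≤
      frobeniusNormSq (fderiv ℝ (twoScale f L lam) x) := by
    intro x
    rw [hD x, ← frobeniusNormSq_smul_eq]
    exact frobeniusNormSq_add_ge _ _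
  have hI : ∫ x, ((1 / 2) * (lam ^ 2 * frobeniusNormSq (fderiv ℝ (fun y : E3 => f (lam • y)) x)) -
      frobeniusNormSq (fderiv ℝ (fun y : E3 => f (L⁻¹ • y)) x)) ≤
      ∫ x, frobeniusNormSq (fderiv ℝ (twoScale f L lam) x) :=
    integral_mono (((hi2.const_mul (lam ^ 2)).const_mul (1 / 2)).sub hi1)
      (integrable_frob_of (contDiff_twoScale hf L lam) (hasCompactSupport_twoScale hfc hL.ne' hlam.ne')) fun x => hpt x
  have hE : ∫ x, ((1 / 2) * (lam ^ 2 * frobeniusNormSq (fderiv ℝ (fun y : E3 => f (lam • y)) x)) -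
      frobeniusNormSq (fderiv ℝ (fun y : E3 => f (L⁻¹ • y)) x)) =
      (1 / 2) * (lam ^ 2 * (lam⁻¹ * ∫ y, frobeniusNormSq (fderiv ℝ f y))) -
        L⁻¹⁻¹ * ∫ y, frobeniusNormSq (fderiv ℝ f y) := by
    rw [integral_sub ((hi2.const_mul (lam ^ 2)).const_mul (1 / 2)) hi1, integral_const_mul,
      integral_const_mul, integral_frob_comp_smul f hlam, integral_frob_comp_smul f (inv_pos.2 hL)]
  have e2 : lam ^ 2 * lam⁻¹ = lam := by
    rw [pow_two, mul_assoc, mul_inv_cancel₀ hlam.ne', mul_one]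
  have hfin : (1 / 2) * (lam ^ 2 * (lam⁻¹ * ∫ y, frobeniusNormSq (fderiv ℝ f y))) -
      L⁻¹⁻¹ * ∫ y, frobeniusNormSq (fderiv ℝ f y) =
      ((1 / 2) * lam - L) * ∫ y, frobeniusNormSq (fderiv ℝ f y) := by
    rw [inv_inv]
    calc (1 / 2) * (lam ^ 2 * (lam⁻¹ * ∫ y, frobeniusNormSq (fderiv ℝ f y))) -
          L * ∫ y, frobeniusNormSq (fderiv ℝ f y)
        = (1 / 2) * ((lam ^ 2 * lam⁻¹) * ∫ y, frobeniusNormSq (fderiv ℝ f y)) -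
          L * ∫ y, frobeniusNormSq (fderiv ℝ f y) := by ring
      _ = ((1 / 2) * lam - L) * ∫ y, frobeniusNormSq (fderiv ℝ f y) := by rw [e2]; ring
  linarith [hI, hE, hfin]

/-- **Local energy from above**: every ball of radius `r` carries at most `2m²|B_r| + 2λ⁻¹∫‖f‖²` of the
energy of `u_{L,λ}`, where `m` bounds `‖f‖` pointwise (`L, λ > 0`). [folklore] -/
private theorem setIntegral_ball_twoScale_le {m : ℝ} (hm : ∀ x, ‖f x‖ ≤ m) {L lam : ℝ} (hL : 0 < L)
    (hlam : 0 < lam) (x₀ : E3) (r : ℝ) :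
    ∫ x in ball x₀ r, ‖twoScale f L lam x‖ ^ 2 ≤
      2 * m ^ 2 * (volume (ball (0 : E3) r)).toReal + 2 * lam⁻¹ * ∫ y, ‖f y‖ ^ 2 := by
  have hi2 := integrable_norm_sq_of (contDiff_comp_smul hf lam) (hfc.comp_smul hlam.ne')
  have hvol0 : volume (ball x₀ r) = volume (ball (0 : E3) r) := Measure.addHaar_ball_center volume x₀ r
  have hpt : ∀ x, ‖twoScale f L lam x‖ ^ 2 ≤ 2 * m ^ 2 + 2 * lam ^ 2 * ‖f (lam • x)‖ ^ 2 := by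
    intro x
    have h := norm_add_sq_le_two (f (L⁻¹ • x)) (lam • f (lam • x))
    rw [norm_smul, mul_pow, Real.norm_eq_abs, sq_abs] at h
    have hm' : ‖f (L⁻¹ • x)‖ ^ 2 ≤ m ^ 2 := by
      have h1 := hm (L⁻¹ • x)
      have h0 : 0 ≤ ‖f (L⁻¹ • x)‖ := norm_nonneg _
      nlinarith
    have e : twoScale f L lam x = f (L⁻¹ • x) + lam • f (lam • x) := rfl
    rw [e]
    linarith
  have hint := integrable_norm_sq_of (contDiff_twoScale hf L lam) (hasCompactSupport_twoScale hfc hL.ne' hlam.ne')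
  have hconst : IntegrableOn (fun _ : E3 => 2 * m ^ 2) (ball x₀ r) := integrableOn_const
  have h1 : ∫ x in ball x₀ r, ‖twoScale f L lam x‖ ^ 2 ≤
      ∫ x in ball x₀ r, (2 * m ^ 2 + 2 * lam ^ 2 * ‖f (lam • x)‖ ^ 2) :=
    setIntegral_mono hint.integrableOn (hconst.add (hi2.const_mul _).integrableOn) fun x => hpt x
  have h2 : ∫ x in ball x₀ r, (2 * m ^ 2 + 2 * lam ^ 2 * ‖f (lam • x)‖ ^ 2) =
      (volume (ball x₀ r)).toReal * (2 * m ^ 2) + ∫ x in ball x₀ r, 2 * lam ^ 2 * ‖f (lam • x)‖ ^ 2 := by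
    rw [integral_add hconst (hi2.const_mul _).integrableOn, setIntegral_const, smul_eq_mul]
    rfl
  have h3 : ∫ x in ball x₀ r, 2 * lam ^ 2 * ‖f (lam • x)‖ ^ 2 ≤ ∫ x, 2 * lam ^ 2 * ‖f (lam • x)‖ ^ 2 :=
    setIntegral_le_integral (hi2.const_mul _) (Eventually.of_forall fun x => by positivity)
  have h4 : ∫ x, 2 * lam ^ 2 * ‖f (lam • x)‖ ^ 2 = 2 * lam⁻¹ * ∫ y, ‖f y‖ ^ 2 := by
    rw [integral_const_mul, integral_comp_smul_three (fun y => ‖f y‖ ^ 2) hlam, ← mul_assoc, mul_assoc 2,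
      sq_mul_inv_cube hlam.ne']
  rw [← hvol0]
  linarith [h1, h2, h3, h4]

end Estimates

/-- `∫‖θ‖² > 0` for the tree's compactly supported divergence-free field `θ = curl(η e₂)`. [folklore] -/
private theorem integral_norm_sq_θ_pos : 0 < ∫ x, ‖θ x‖ ^ 2 := by
  obtain ⟨x₀, hx₀⟩ := exists_θ_ne_zero
  have hc : Continuous fun x => ‖θ x‖ ^ 2 := (θ_contDiff.continuous.norm).pow 2
  have hcs : HasCompactSupport fun x => ‖θ x‖ ^ 2 :=
    (θ_hasCompactSupport.norm).comp_left (g := fun t : ℝ => t ^ 2) (by simp)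
  have h0 : (fun x => ‖θ x‖ ^ 2) x₀ ≠ 0 := by simpa using hx₀
  exact hc.integral_pos_of_hasCompactSupport_nonneg_nonzero hcs (fun x => by positivity) h0

/-- `∫|Dθ|²_F > 0`: else `Dθ ≡ 0`, `θ` constant and compactly supported, so `θ ≡ 0` — false. [folklore] -/
private theorem integral_frob_θ_pos : 0 < ∫ x, frobeniusNormSq (fderiv ℝ θ x) := by
  have hcont : Continuous fun x => frobeniusNormSq (fderiv ℝ θ x) := continuous_frobeniusNormSq_fderiv θ_contDiff (by simp)
  have hcs : HasCompactSupport fun x => frobeniusNormSq (fderiv ℝ θ x) :=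
    (θ_hasCompactSupport.fderiv (𝕜 := ℝ)).comp_left (g := frobeniusNormSq) (by simp [frobeniusNormSq])
  have hD : ∃ x₁, fderiv ℝ θ x₁ ≠ 0 := by
    by_contra h
    push Not at h
    have hdiff : Differentiable ℝ θ := θ_contDiff.differentiable (by simp)
    have hconst : ∀ x y, θ x = θ y := fun x y => is_const_of_fderiv_eq_zero hdiff h x y
    obtain ⟨z, hz⟩ : ∃ z, z ∉ tsupport θ := by
      by_contra hall
      push Not at hall
      have huniv : tsupport θ = univ := eq_univ_of_forall hall
      have hcpt : IsCompact (univ : Set E3) := huniv ▸ θ_hasCompactSupport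
      exact noncompact_univ E3 hcpt
    have hz0 : θ z = 0 := image_eq_zero_of_notMem_tsupport hz
    obtain ⟨x₀, hx₀⟩ := exists_θ_ne_zero
    exact hx₀ ((hconst x₀ z).trans hz0)
  obtain ⟨x₁, hx₁⟩ := hD
  have h1 : (fun x => frobeniusNormSq (fderiv ℝ θ x)) x₁ ≠ 0 :=
    ((pow_pos (norm_pos_iff.2 hx₁) 2).trans_le (sq_opNorm_le_frobeniusNormSq (fderiv ℝ θ x₁))).ne'
  exact hcont.integral_pos_of_hasCompactSupport_nonneg_nonzero hcs (fun x => frobeniusNormSq_nonneg _) h1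

/-- **Barrier entry (D-0021, method level): ENERGY DISPERSAL DOES NOT CONTROL THE ENSTROPHY.** For every
radius `r > 0` and every `C` there is a smooth, compactly supported, divergence-free `u` on `ℝ³` with non-zero energy
such that EVERY ball of radius `r` carries less than a quarter of `∫|u|²` (so every «energy concentration radius»
of `u` is `≥ r`) and yet `r² ∫|∇u|²_F ≥ C ∫|u|²`: no law `R(u)²·X(u) ≤ C·E(u)` with `R` read off `|u|²` holds,
although such laws are dimensionally consistent. Physical-space vs frequency-space length scales
(`κ_{1,0} = (H₁/H₀)^{1/2}`). [cite: DoeringGibbon1995, §6.3 (6.3.4)–(6.3.8) pp.125–127]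
[cite: Tao2007WhyNSHard, supercriticality paragraph (rescaling `u^{(λ)}`)] -/
def EnergyDispersalNoEnstrophyControl : Prop :=
  ∀ r : ℝ, 0 < r → ∀ C : ℝ, ∃ u : E3 → E3,
    ContDiff ℝ ∞ u ∧ HasCompactSupport u ∧ VectorCalculus.IsDivFree u ∧
    0 < ∫ x, ‖u x‖ ^ 2 ∧
    (∀ x₀ : E3, ∫ x in ball x₀ r, ‖u x‖ ^ 2 < (1 / 4) * ∫ x, ‖u x‖ ^ 2) ∧
    C * ∫ x, ‖u x‖ ^ 2 ≤ r ^ 2 * ∫ x, frobeniusNormSq (fderiv ℝ u x)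

/-- **The barrier holds** (kernel): witness `u = twoScale θ L λ` with `L³ = 16m²|B_r|/∫‖θ‖² + 20`
(`m` a bound for `‖θ‖`) and `λ = 2L + 4|C|(L³+1)∫‖θ‖²/(r²∫|Dθ|²_F) + 1`, by the four estimates of §C.
[cite: DoeringGibbon1995, §6.3 (6.3.4)–(6.3.8) pp.125–127] -/
theorem energyDispersalNoEnstrophyControl_holds : EnergyDispersalNoEnstrophyControl := by
  intro r hr C
  set a : ℝ := ∫ y, ‖θ y‖ ^ 2 with ha
  set b : ℝ := ∫ y, frobeniusNormSq (fderiv ℝ θ y) with hb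
  have ha0 : 0 < a := integral_norm_sq_θ_pos
  have hb0 : 0 < b := integral_frob_θ_pos
  obtain ⟨m, hm⟩ := θ_contDiff.continuous.bounded_above_of_compact_support θ_hasCompactSupport
  set V : ℝ := (volume (ball (0 : E3) r)).toReal with hV
  have hV0 : 0 ≤ V := ENNReal.toReal_nonneg
  set t : ℝ := m ^ 2 * V / a with ht
  have ht0 : 0 ≤ t := by positivity
  set T : ℝ := 16 * t + 20 with hT
  have hT0 : 0 < T := by positivity
  set L : ℝ := T ^ ((1 : ℝ) / 3) with hL
  have hL0 : 0 < L := Real.rpow_pos_of_pos hT0 _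
  have hL3 : L ^ 3 = T := by rw [hL, ← Real.rpow_natCast, ← Real.rpow_mul hT0.le]; norm_num
  set lam : ℝ := 2 * L + 4 * |C| * (T + 1) * a / (r ^ 2 * b) + 1 with hlam
  have hlam1 : 1 ≤ lam := by
    have : 0 ≤ 4 * |C| * (T + 1) * a / (r ^ 2 * b) := by positivity
    linarith
  have hlam0 : 0 < lam := by linarith
  have hlaminv : lam⁻¹ ≤ 1 := inv_le_one_of_one_le₀ hlam1
  have hta : t * a = m ^ 2 * V := by rw [ht]; field_simp
  obtain ⟨hge, hle⟩ := integral_norm_sq_twoScale_bounds θ_contDiff θ_hasCompactSupport hL0 hlam0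
  have hcoef : 8 * t + 9 ≤ (1 / 2) * L ^ 3 - lam⁻¹ := by rw [hL3, hT]; linarith
  have hlow : 8 * (m ^ 2 * V) + 9 * a ≤ ∫ x, ‖twoScale θ L lam x‖ ^ 2 := by
    have h1 : (8 * t + 9) * a ≤ ((1 / 2) * L ^ 3 - lam⁻¹) * a := mul_le_mul_of_nonneg_right hcoef ha0.le
    have h2 : (8 * t + 9) * a = 8 * (m ^ 2 * V) + 9 * a := by rw [← hta]; ring
    linarith
  have hmV : 0 ≤ m ^ 2 * V := by positivity
  refine ⟨twoScale θ L lam, contDiff_twoScale θ_contDiff L lam,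
    hasCompactSupport_twoScale θ_hasCompactSupport hL0.ne' hlam0.ne', isDivFree_twoScale θ_contDiff θ_isDivFree L lam,
    ?_, ?_, ?_⟩
  · linarith
  · intro x₀ -- dispersal: every `r`-ball holds `< ¼` of the energy
    have hloc := setIntegral_ball_twoScale_le θ_contDiff θ_hasCompactSupport hm hL0 hlam0 x₀ r
    rw [← hV] at hloc
    have h3 : 2 * lam⁻¹ * a ≤ 2 * a := by nlinarith
    linarith
  · have hfr := integral_frob_twoScale_ge θ_contDiff θ_hasCompactSupport hL0 hlam0
    have hup : ∫ x, ‖twoScale θ L lam x‖ ^ 2 ≤ (2 * T + 2) * a :=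
      hle.trans (mul_le_mul_of_nonneg_right (by rw [hL3]; linarith) ha0.le)
    have hC : C * ∫ x, ‖twoScale θ L lam x‖ ^ 2 ≤ |C| * ((2 * T + 2) * a) :=
      (mul_le_mul_of_nonneg_right (le_abs_self C) (by linarith)).trans (mul_le_mul_of_nonneg_left hup (abs_nonneg C))
    have hkey : r ^ 2 * (((1 / 2) * lam - L) * b) = 2 * |C| * (T + 1) * a + (1 / 2) * r ^ 2 * b := by
      rw [hlam]; field_simp; ring
    have hrb : 0 ≤ (1 / 2) * r ^ 2 * b := by positivity
    have hmono : r ^ 2 * (((1 / 2) * lam - L) * b) ≤ r ^ 2 * ∫ x, frobeniusNormSq (fderiv ℝ (twoScale θ L lam) x) :=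
      mul_le_mul_of_nonneg_left hfr (by positivity)
    nlinarith [hC, hkey, hrb, hmono]

end EnergyDispersal

end Literature.Barriers.NavierStokesRegularity

end
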